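import Mathlib
import HarnessLib
import Literature.Probability.MarkovChains.HardcoreGlauberGrandCoupling
import Literature.Probability.MarkovChains.DistinguishingStatistic

/-!
# The lazy random walk on the hypercube needs `½ n log n − O(n)` steps: `d(½ n log n − αn) ≥ 1 − 8e^{2−2α}` (Levin–Peres–Wilmer Proposition 7.14)

HONEST FRAMING: exact (Metropolis-corrected) sampling algorithms for lattice gauge theory; figures
of merit are autocorrelation/cost numbers at stated couplings and volumes; no continuum-physics claim.

Conventions of `HardcoreGlauberGrandCoupling.lean` (Part C: `lazyHypercubeWalk V`, the lazy walk on
`{0,1}^V` run by random refreshes, `refreshMap`, `refreshWeight`, `uniformCube`;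
`randomMapKernel`), `DistinguishingStatistic.lean` (`lawMean`, `lawVariance`, Proposition 7.9
`LevinPeres2017_prop_7_9_chain`), `TotalVariation.lean` (`lawAt`, `stepLaw`, `tvDist`) and
`BottleneckRatio.lean` (`worstTvDist = d(t)`).  Source: D. A. Levin, Y. Peres (with E. L. Wilmer),
*Markov Chains and Mixing Times*, 2nd ed., AMS 2017 [LevinPeres2017], §7.3.1 Proposition 7.14 and
its proof (pp. 95–96).  Everything is PROVED (finite sums; 0 named facts).

* generic: `lawMean_stepLaw` (`E_{μP} f = E_μ(Pf)`), `lawMean_lawAt_of_eigen` (for an eigenfunction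
  `Pf = λf`: `E_{μPᵗ} f = λᵗ E_μ f`), `lawMean_single`, `randomMapKernel_sum_mul`,
  `lawVariance_eq_sub` (`Var_μ f = E_μ(f − c)² − (E_μ f − c)²`);
* the statistic: `bitVal`, `bitWeight = W` ("the Hamming weight `W(x) = Σ_i x_i`");
  `hypercube_step_centered` — `P(x_j − ½) = (1 − 1/n)(x_j − ½)` and `hypercube_step_pair` —
  `P[(x_j − ½)(x_k − ½)] = (1 − 2/n)(x_j − ½)(x_k − ½)` for `j ≠ k` (the refresh representation);
  hence **`E_𝟙 W(X_t) = (n/2)[1 + (1 − 1/n)ᵗ]`** (`LevinPeres2017_eq_7_18_weight`, the book's display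
  after (7.18)) and **`Var_𝟙 W(X_t) ≤ n/4`** (`var_weight_lawAt_le`; the book derives it from
  `Var(R_t) ≤ E(R_t)`, Lemma 7.13 — here from the second eigen-mode `(1 − 2/n)ᵗ ≤ (1 − 1/n)^{2t}`,
  a ROUTE deviation giving the same inequality), and under the uniform law `E_π W = n/2`,
  `Var_π W = n/4` (`mean_weight_uniform`, `var_weight_uniform`) [cite: LevinPeres2017, §7.3.1 proof
  of Prop. 7.14 (the displays for `E_π(W)`, `Var_π(W)`, `E_𝟙(W(X_t))`, `Var_𝟙(W(X_t)) ≤ n/4`)];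
* `sqrt_mul_pow_ge` — "using that `(1 − 1/n)^{n−1} > e^{−1}`": for `t ≤ ½ n log n − αn`,
  `√n (1 − 1/n)ᵗ ≥ e^{α−1}`, so `|E_π(W) − E_𝟙(W(X_t))| ≥ e^{α−1}σ` with `σ = √n/2`;
* **PROPOSITION 7.14** `LevinPeres2017_prop_7_14`: for the lazy random walk on the `n`-dimensional
  hypercube (`n ≥ 2`) and every integer `t ≤ ½ n log n − αn`, **`d(t) ≥ 1 − 8e^{2−2α}`** (eq. (7.20),
  via Proposition 7.9 = eq. (7.21)) [cite: LevinPeres2017, §7.3.1 Prop. 7.14, eqs. (7.20)–(7.21)].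

SCOPE: the book's `d(½ n log n − αn)` at a real argument is rendered as "every natural `t` not
exceeding `½ n log n − αn`" (for `α ≤ 1` the bound is negative and trivially true).  Context (cell
pub-lqcd, venture LatticeQCDFlow): the matching lower bound to eq. (5.6) (`HardcoreGlauberGrandCoupling`,
Part C) — an observable (`W`) whose mean has not relaxed certifies non-mixing: the diagnostic logic
of comparing one observable's drift against its equilibrium spread.
-/

namespace Literature.Probability.MarkovChains

open Finset Function

/-! ## Generic: expectations along the chain for eigenfunctions -/

section Eigen

variable {X : Type*} [Fintype X]

/-- `E_{μP}[f] = E_μ[Pf]`. [cite: LevinPeres2017, §1.1 (`μ_t = μ_{t−1}P`) with §12.1 eq. (12.2)] -/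
theorem lawMean_stepLaw (P : X → X → ℝ) (μ : X → ℝ) (f : X → ℝ) :
    lawMean (stepLaw P μ) f = lawMean μ (fun z => ∑ y, P z y * f y) := by
  unfold lawMean stepLaw
  simp_rw [sum_mul, mul_sum]
  rw [sum_comm]
  exact sum_congr rfl fun z _ => sum_congr rfl fun y _ => by ring

/-- For an eigenfunction `Pf = λf`: **`E_{μPᵗ}[f] = λᵗ E_μ[f]`**. [cite: LevinPeres2017, §12.1
eq. (12.2)–(12.5) (eigenfunction expansions of `Pᵗ`)] -/
theorem lawMean_lawAt_of_eigen (P : X → X → ℝ) (μ : X → ℝ) {f : X → ℝ} {lam : ℝ}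
    (hf : ∀ z, ∑ y, P z y * f y = lam * f z) :
    ∀ t : ℕ, lawMean (lawAt P μ t) f = lam ^ t * lawMean μ f := by
  intro t
  induction t with
  | zero => rw [lawAt_zero, pow_zero, one_mul]
  | succ t ih =>
      rw [lawAt_succ, lawMean_stepLaw]
      simp_rw [hf]
      unfold lawMean at ih ⊢
      rw [pow_succ]
      calc ∑ x, lawAt P μ t x * (lam * f x) = lam * ∑ x, lawAt P μ t x * f x := by
            rw [mul_sum]; exact sum_congr rfl fun x _ => by ring
        _ = lam ^ t * lam * ∑ x, μ x * f x := by rw [ih]; ring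

/-- `E_{δ_x}[f] = f(x)`. [cite: LevinPeres2017, §1.1] -/
theorem lawMean_single [DecidableEq X] (x : X) (f : X → ℝ) : lawMean (Pi.single x 1) f = f x := by
  unfold lawMean
  simp_rw [Pi.single_apply, ite_mul, one_mul, zero_mul]
  rw [sum_ite_eq' univ x, if_pos (mem_univ _)]

/-- Linearity: `E_μ[Σ_j f_j] = Σ_j E_μ[f_j]`. [cite: LevinPeres2017, §12.1] -/
theorem lawMean_sum {J : Type*} [Fintype J] (μ : X → ℝ) (f : J → X → ℝ) :
    lawMean μ (fun x => ∑ j, f j x) = ∑ j, lawMean μ (f j) := by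
  unfold lawMean
  simp_rw [mul_sum]
  rw [sum_comm]

/-- `E_μ[f + c] = E_μ[f] + c` for a probability vector `μ`. [cite: LevinPeres2017, §12.1] -/
theorem lawMean_add_const {μ : X → ℝ} (hμ1 : ∑ x, μ x = 1) (f : X → ℝ) (c : ℝ) :
    lawMean μ (fun x => f x + c) = lawMean μ f + c := by
  unfold lawMean
  simp_rw [mul_add]
  rw [sum_add_distrib, ← sum_mul, hμ1, one_mul]

/-- `Var_μ(f) = E_μ[(f − c)²] − (E_μ[f] − c)²` for a probability vector `μ` and any centre `c`.
[cite: LevinPeres2017, §7.3 (variance of a statistic)] -/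
theorem lawVariance_eq_sub {μ : X → ℝ} (hμ1 : ∑ x, μ x = 1) (f : X → ℝ) (c : ℝ) :
    lawVariance μ f = lawMean μ (fun x => (f x - c) ^ 2) - (lawMean μ f - c) ^ 2 := by
  unfold lawVariance lawMean
  set m := ∑ x, μ x * f x with hm
  have h1 : ∑ x, μ x * (f x - c) ^ 2 = ∑ x, μ x * (f x - m) ^ 2 + 2 * (m - c) * ∑ x, μ x * (f x - m) +
      (m - c) ^ 2 * ∑ x, μ x := by
    rw [mul_sum, mul_sum, ← sum_add_distrib, ← sum_add_distrib]
    exact sum_congr rfl fun x _ => by ring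
  have h2 : ∑ x, μ x * (f x - m) = 0 := by
    simp_rw [mul_sub]
    rw [sum_sub_distrib, ← sum_mul, hμ1, one_mul, hm, sub_self]
  rw [h1, h2, hμ1]
  ring

/-- `Σ_y P(x,y) f(y) = Σ_m w_m f(F_m x)` for the chain of a random mapping representation.
[cite: LevinPeres2017, §1.2 (random mapping representation)] -/
theorem randomMapKernel_sum_mul [DecidableEq X] {I : Type*} [Fintype I] (w : I → ℝ) (F : I → X → X)
    (x : X) (f : X → ℝ) :
    ∑ y, randomMapKernel w F x y * f y = ∑ m, w m * f (F m x) := by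
  unfold randomMapKernel
  simp_rw [sum_mul]
  rw [sum_comm]
  refine sum_congr rfl fun m _ => ?_
  simp_rw [ite_mul, zero_mul]
  rw [sum_ite_eq univ (F m x), if_pos (mem_univ _)]

end Eigen

/-! ## The Hamming weight under the lazy hypercube walk -/

section Hypercube

variable {V : Type*} [Fintype V] [DecidableEq V]

/-- The bit `x_i ∈ {0,1}` as a real number. [cite: LevinPeres2017, §7.3.1 (`x = (x_1,…,x_n) ∈ {0,1}ⁿ`)] -/
def bitVal (x : V → Bool) (i : V) : ℝ := bif x i then 1 else 0

/-- **The Hamming weight `W(x) = Σ_i x_i`.** [cite: LevinPeres2017, §7.3.1 proof of Prop. 7.14] -/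
def bitWeight (x : V → Bool) : ℝ := ∑ i, bitVal x i

omit [Fintype V] in
/-- Refreshing coordinate `i` leaves `x_j` (`j ≠ i`) unchanged. [cite: LevinPeres2017, §7.3.1] -/
theorem bitVal_update_of_ne (x : V → Bool) {i j : V} (h : j ≠ i) (b : Bool) :
    bitVal (update x i b) j = bitVal x j := by
  unfold bitVal; rw [update_of_ne h]

omit [Fintype V] [DecidableEq V] in
/-- `(x_i − ½)² = ¼`. [cite: LevinPeres2017, §7.3.1 (`W` is a sum of bits)] -/
theorem bitVal_sub_half_sq (x : V → Bool) (i : V) : (bitVal x i - 1 / 2) ^ 2 = 1 / 4 := by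
  unfold bitVal; cases x i <;> norm_num

variable [Nonempty V]

/-- First eigen-mode: **`Σ_y P(x,y)(y_j − ½) = (1 − 1/n)(x_j − ½)`** for the lazy hypercube walk.
[cite: LevinPeres2017, §7.3.1 proof of Prop. 7.14 (the computation of `E_𝟙(W(X_t))` via (7.18))] -/
theorem hypercube_step_centered (x : V → Bool) (j : V) :
    ∑ y, lazyHypercubeWalk V x y * (bitVal y j - 1 / 2) =
      (1 - (Fintype.card V : ℝ)⁻¹) * (bitVal x j - 1 / 2) := by
  unfold lazyHypercubeWalk
  rw [randomMapKernel_sum_mul, Fintype.sum_prod_type]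
  unfold refreshWeight refreshMap
  simp only
  rw [← sum_erase_add _ _ (mem_univ j)]
  have hj : ∑ b : Bool, (Fintype.card V : ℝ)⁻¹ * (1 / 2) * (bitVal (update x j b) j - 1 / 2) = 0 := by
    rw [Fintype.sum_bool]
    simp only [bitVal, update_self, Bool.cond_true, Bool.cond_false]
    ring
  have hne : ∀ i ∈ univ.erase j, ∑ b : Bool, (Fintype.card V : ℝ)⁻¹ * (1 / 2) *
      (bitVal (update x i b) j - 1 / 2) = (Fintype.card V : ℝ)⁻¹ * (bitVal x j - 1 / 2) := by
    intro i hi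
    simp_rw [bitVal_update_of_ne x (ne_of_mem_erase hi).symm]
    rw [Fintype.sum_bool]; ring
  rw [hj, add_zero, sum_congr rfl hne, sum_const, card_erase_of_mem (mem_univ j), card_univ,
    nsmul_eq_mul, Nat.cast_sub Fintype.card_pos, Nat.cast_one]
  have hn : (Fintype.card V : ℝ) ≠ 0 := by exact_mod_cast Fintype.card_pos.ne'
  field_simp

/-- Second eigen-mode: **`Σ_y P(x,y)(y_j − ½)(y_k − ½) = (1 − 2/n)(x_j − ½)(x_k − ½)`** for `j ≠ k`.
[cite: LevinPeres2017, §7.3.1 proof of Prop. 7.14 (the variance computation), with §12.4 (product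
chains: eigenfunctions are products)] -/
theorem hypercube_step_pair (x : V → Bool) {j k : V} (hjk : j ≠ k) :
    ∑ y, lazyHypercubeWalk V x y * ((bitVal y j - 1 / 2) * (bitVal y k - 1 / 2)) =
      (1 - 2 * (Fintype.card V : ℝ)⁻¹) * ((bitVal x j - 1 / 2) * (bitVal x k - 1 / 2)) := by
  unfold lazyHypercubeWalk
  rw [randomMapKernel_sum_mul, Fintype.sum_prod_type]
  unfold refreshWeight refreshMap
  simp only
  have hkj : k ∈ univ.erase j := mem_erase.2 ⟨hjk.symm, mem_univ k⟩
  rw [← sum_erase_add _ _ (mem_univ j), ← sum_erase_add _ _ hkj]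
  have hj : ∑ b : Bool, (Fintype.card V : ℝ)⁻¹ * (1 / 2) *
      ((bitVal (update x j b) j - 1 / 2) * (bitVal (update x j b) k - 1 / 2)) = 0 := by
    rw [Fintype.sum_bool]
    simp only [bitVal, update_self, update_of_ne hjk.symm, Bool.cond_true, Bool.cond_false]
    ring
  have hk : ∑ b : Bool, (Fintype.card V : ℝ)⁻¹ * (1 / 2) *
      ((bitVal (update x k b) j - 1 / 2) * (bitVal (update x k b) k - 1 / 2)) = 0 := by
    rw [Fintype.sum_bool]
    simp only [bitVal, update_self, update_of_ne hjk, Bool.cond_true, Bool.cond_false]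
    ring
  have hne : ∀ i ∈ (univ.erase j).erase k, ∑ b : Bool, (Fintype.card V : ℝ)⁻¹ * (1 / 2) *
      ((bitVal (update x i b) j - 1 / 2) * (bitVal (update x i b) k - 1 / 2)) =
        (Fintype.card V : ℝ)⁻¹ * ((bitVal x j - 1 / 2) * (bitVal x k - 1 / 2)) := by
    intro i hi
    have hik : i ≠ k := ne_of_mem_erase hi
    have hij : i ≠ j := ne_of_mem_erase (mem_of_mem_erase hi)
    simp_rw [bitVal_update_of_ne x hij.symm, bitVal_update_of_ne x hik.symm]
    rw [Fintype.sum_bool]; ring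
  rw [hj, hk, add_zero, add_zero, sum_congr rfl hne, sum_const, card_erase_of_mem hkj,
    card_erase_of_mem (mem_univ j), card_univ, nsmul_eq_mul]
  have h2 : 2 ≤ Fintype.card V := by
    have : ({j, k} : Finset V).card ≤ Fintype.card V := card_le_univ _
    rwa [card_pair hjk] at this
  rw [Nat.cast_sub (by omega), Nat.cast_sub (by omega)]
  have hn : (Fintype.card V : ℝ) ≠ 0 := by exact_mod_cast Fintype.card_pos.ne'
  push_cast
  field_simp
  ring

/-- **`E_𝟙[W(X_t)] = (n/2)[1 + (1 − 1/n)ᵗ]`** (the walk started from the all-ones vector `𝟙`).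
[cite: LevinPeres2017, §7.3.1 proof of Prop. 7.14 (the display after (7.18))] -/
theorem LevinPeres2017_eq_7_18_weight (t : ℕ) :
    lawMean (lawAt (lazyHypercubeWalk V) (Pi.single (fun _ : V => true) 1) t) bitWeight =
      (Fintype.card V : ℝ) / 2 * (1 + (1 - (Fintype.card V : ℝ)⁻¹) ^ t) := by
  have hdecomp : (bitWeight : (V → Bool) → ℝ) =
      fun x => (∑ j, (bitVal x j - 1 / 2)) + (Fintype.card V : ℝ) / 2 := by
    funext x
    unfold bitWeight
    rw [sum_sub_distrib, sum_const, card_univ, nsmul_eq_mul]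
    ring
  have h1 : ∑ z, lawAt (lazyHypercubeWalk V) (Pi.single (fun _ : V => true) 1) t z = 1 := by
    rw [sum_lawAt lazyHypercubeWalk_isRowStochastic, Finset.sum_pi_single']
    simp
  rw [hdecomp, lawMean_add_const h1, lawMean_sum]
  have hj : ∀ j : V, lawMean (lawAt (lazyHypercubeWalk V) (Pi.single (fun _ : V => true) 1) t)
      (fun x => bitVal x j - 1 / 2) = (1 - (Fintype.card V : ℝ)⁻¹) ^ t * (1 / 2) := by
    intro j
    rw [lawMean_lawAt_of_eigen _ _ (fun z => hypercube_step_centered z j), lawMean_single]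
    simp only [bitVal, Bool.cond_true]
    norm_num
  simp_rw [hj]
  rw [sum_const, card_univ, nsmul_eq_mul]
  ring

/-- **`E_𝟙[(W(X_t) − n/2)²] = n/4 + (1 − 2/n)ᵗ·n(n−1)/4`** (second moment from the two eigen-modes).
[cite: LevinPeres2017, §7.3.1 proof of Prop. 7.14 (the variance computation)] -/
theorem second_moment_weight_lawAt (t : ℕ) :
    lawMean (lawAt (lazyHypercubeWalk V) (Pi.single (fun _ : V => true) 1) t)
        (fun x => (bitWeight x - (Fintype.card V : ℝ) / 2) ^ 2) =
      (Fintype.card V : ℝ) / 4 +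
        (1 - 2 * (Fintype.card V : ℝ)⁻¹) ^ t * ((Fintype.card V : ℝ) * ((Fintype.card V : ℝ) - 1) / 4) := by
  set μ := lawAt (lazyHypercubeWalk V) (Pi.single (fun _ : V => true) 1) t with hμ
  -- `(W − n/2)² = Σ_j (x_j − ½)² + Σ_j Σ_{k ≠ j} (x_j − ½)(x_k − ½) = n/4 + Σ_j Σ_{k≠j} …`
  have hdecomp : (fun x : V → Bool => (bitWeight x - (Fintype.card V : ℝ) / 2) ^ 2) =
      fun x => (∑ j, ∑ k ∈ univ.erase j, (bitVal x j - 1 / 2) * (bitVal x k - 1 / 2)) +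
        (Fintype.card V : ℝ) / 4 := by
    funext x
    have hW : bitWeight x - (Fintype.card V : ℝ) / 2 = ∑ j, (bitVal x j - 1 / 2) := by
      unfold bitWeight
      rw [sum_sub_distrib, sum_const, card_univ, nsmul_eq_mul]; ring
    rw [hW, sq, sum_mul_sum]
    have hsplit : ∀ j, ∑ k, (bitVal x j - 1 / 2) * (bitVal x k - 1 / 2) =
        (∑ k ∈ univ.erase j, (bitVal x j - 1 / 2) * (bitVal x k - 1 / 2)) + 1 / 4 := by
      intro j
      rw [← sum_erase_add _ _ (mem_univ j), ← sq, bitVal_sub_half_sq]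
    simp_rw [hsplit]
    rw [sum_add_distrib, sum_const, card_univ, nsmul_eq_mul]
    ring
  have h1 : ∑ z, μ z = 1 := by
    rw [hμ, sum_lawAt lazyHypercubeWalk_isRowStochastic, Finset.sum_pi_single']
    simp
  rw [hdecomp, lawMean_add_const h1, lawMean_sum]
  have hjk : ∀ j : V, lawMean μ (fun x => ∑ k ∈ univ.erase j, (bitVal x j - 1 / 2) * (bitVal x k - 1 / 2)) =
      ∑ k ∈ univ.erase j, (1 - 2 * (Fintype.card V : ℝ)⁻¹) ^ t * (1 / 4) := by
    intro j
    have hlin : lawMean μ (fun x => ∑ k ∈ univ.erase j, (bitVal x j - 1 / 2) * (bitVal x k - 1 / 2)) =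
        ∑ k ∈ univ.erase j, lawMean μ (fun x => (bitVal x j - 1 / 2) * (bitVal x k - 1 / 2)) := by
      unfold lawMean
      simp_rw [mul_sum]
      rw [sum_comm]
    rw [hlin]
    refine sum_congr rfl fun k hk => ?_
    rw [hμ, lawMean_lawAt_of_eigen _ _ (fun z => hypercube_step_pair z (ne_of_mem_erase hk).symm),
      lawMean_single]
    simp only [bitVal, Bool.cond_true]
    norm_num
  simp_rw [hjk]
  rw [sum_congr rfl fun j _ => by rw [sum_const, card_erase_of_mem (mem_univ j), card_univ,
    nsmul_eq_mul], sum_const, card_univ, nsmul_eq_mul, Nat.cast_sub Fintype.card_pos, Nat.cast_one]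
  ring

/-- **`Var_𝟙(W(X_t)) ≤ n/4`** (`n ≥ 2`). [cite: LevinPeres2017, §7.3.1 proof of Prop. 7.14 ("We conclude
that `Var_𝟙(W(X_t)) ≤ n/4`")] -/
theorem var_weight_lawAt_le (hn : 2 ≤ Fintype.card V) (t : ℕ) :
    lawVariance (lawAt (lazyHypercubeWalk V) (Pi.single (fun _ : V => true) 1) t) bitWeight ≤
      (Fintype.card V : ℝ) / 4 := by
  set n : ℝ := (Fintype.card V : ℝ) with hndef
  have h1 : ∑ z, lawAt (lazyHypercubeWalk V) (Pi.single (fun _ : V => true) 1) t z = 1 := by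
    rw [sum_lawAt lazyHypercubeWalk_isRowStochastic, Finset.sum_pi_single']
    simp
  rw [lawVariance_eq_sub h1 bitWeight (n / 2), second_moment_weight_lawAt,
    LevinPeres2017_eq_7_18_weight]
  have hn2 : (2 : ℝ) ≤ n := by rw [hndef]; exact_mod_cast hn
  have hn0 : 0 < n := by linarith
  -- `(1 − 2/n)ᵗ ≤ ((1 − 1/n)²)ᵗ = (1 − 1/n)^{2t}`
  have hbase0 : 0 ≤ 1 - 2 * n⁻¹ := by
    rw [sub_nonneg]
    calc 2 * n⁻¹ = 2 / n := by ring
      _ ≤ 1 := by rw [div_le_one hn0]; exact hn2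
  have hbase : 1 - 2 * n⁻¹ ≤ (1 - n⁻¹) ^ 2 := by nlinarith [sq_nonneg n⁻¹]
  have hpow : (1 - 2 * n⁻¹) ^ t ≤ ((1 - n⁻¹) ^ t) ^ 2 := by
    rw [← pow_mul, mul_comm t 2, pow_mul]
    exact pow_le_pow_left₀ hbase0 hbase t
  have hA : 0 ≤ n * (n - 1) / 4 := by nlinarith
  nlinarith [mul_le_mul_of_nonneg_right hpow hA, sq_nonneg ((1 - n⁻¹) ^ t)]

/-- Flipping one coordinate is an involution of `{0,1}^V`. [cite: LevinPeres2017, §2.3 (the hypercube)] -/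
def flipAt (j : V) : (V → Bool) ≃ (V → Bool) where
  toFun x := update x j (!x j)
  invFun x := update x j (!x j)
  left_inv x := by
    funext i
    by_cases h : i = j
    · subst h; simp
    · simp [update_of_ne h]
  right_inv x := by
    funext i
    by_cases h : i = j
    · subst h; simp
    · simp [update_of_ne h]

omit [Nonempty V] in
/-- `Σ_x (x_j − ½) g(x) = 0` whenever `g` does not depend on the `j`-th coordinate (flip symmetry);
used with `g = 1` and `g = x_k − ½`. [cite: LevinPeres2017, §7.3.1 ("As `π` is uniform on `{0,1}ⁿ`
… `W` … is binomial … `E_π(W) = n/2`, `Var_π(W) = n/4`")] -/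
theorem sum_centered_mul_eq_zero (j : V) {g : (V → Bool) → ℝ} (hg : ∀ x, g (update x j (!x j)) = g x) :
    ∑ x : V → Bool, (bitVal x j - 1 / 2) * g x = 0 := by
  have h := Fintype.sum_equiv (flipAt j) (fun x => (bitVal (flipAt j x) j - 1 / 2) * g (flipAt j x))
    (fun x => (bitVal x j - 1 / 2) * g x) (fun _ => rfl)
  have hneg : ∀ x : V → Bool, (bitVal (flipAt j x) j - 1 / 2) * g (flipAt j x) =
      -((bitVal x j - 1 / 2) * g x) := by
    intro x
    show (bitVal (update x j (!x j)) j - 1 / 2) * g (update x j (!x j)) = _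
    rw [hg]
    unfold bitVal
    rw [update_self]
    cases x j <;> simp only [Bool.not_true, Bool.not_false, Bool.cond_true, Bool.cond_false] <;> ring
  simp_rw [hneg, sum_neg_distrib] at h
  linarith

omit [Nonempty V] in
/-- **`E_π(W) = n/2`** under the uniform law on `{0,1}ⁿ`. [cite: LevinPeres2017, §7.3.1 proof of
Prop. 7.14] -/
theorem mean_weight_uniform :
    lawMean (uniformCube V) (bitWeight : (V → Bool) → ℝ) = (Fintype.card V : ℝ) / 2 := by
  have hdecomp : (bitWeight : (V → Bool) → ℝ) =
      fun x => (∑ j, (bitVal x j - 1 / 2) * 1) + (Fintype.card V : ℝ) / 2 := by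
    funext x
    unfold bitWeight
    simp_rw [mul_one]
    rw [sum_sub_distrib, sum_const, card_univ, nsmul_eq_mul]; ring
  rw [hdecomp, lawMean_add_const sum_uniformCube, lawMean_sum]
  have hj : ∀ j : V, lawMean (uniformCube V) (fun x => (bitVal x j - 1 / 2) * 1) = 0 := by
    intro j
    unfold lawMean uniformCube
    rw [← mul_sum, sum_centered_mul_eq_zero j (fun _ => rfl), mul_zero]
  simp_rw [hj]
  rw [sum_const_zero, zero_add]

omit [Nonempty V] in
/-- **`Var_π(W) = n/4`** under the uniform law on `{0,1}ⁿ` (`W ∼ Bin(n, ½)`).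
[cite: LevinPeres2017, §7.3.1 proof of Prop. 7.14] -/
theorem var_weight_uniform :
    lawVariance (uniformCube V) (bitWeight : (V → Bool) → ℝ) = (Fintype.card V : ℝ) / 4 := by
  rw [lawVariance_eq_sub sum_uniformCube bitWeight ((Fintype.card V : ℝ) / 2), mean_weight_uniform,
    sub_self, zero_pow two_ne_zero, sub_zero]
  have hdecomp : (fun x : V → Bool => (bitWeight x - (Fintype.card V : ℝ) / 2) ^ 2) =
      fun x => (∑ j, ∑ k ∈ univ.erase j, (bitVal x j - 1 / 2) * (bitVal x k - 1 / 2)) +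
        (Fintype.card V : ℝ) / 4 := by
    funext x
    have hW : bitWeight x - (Fintype.card V : ℝ) / 2 = ∑ j, (bitVal x j - 1 / 2) := by
      unfold bitWeight
      rw [sum_sub_distrib, sum_const, card_univ, nsmul_eq_mul]; ring
    rw [hW, sq, sum_mul_sum]
    have hsplit : ∀ j, ∑ k, (bitVal x j - 1 / 2) * (bitVal x k - 1 / 2) =
        (∑ k ∈ univ.erase j, (bitVal x j - 1 / 2) * (bitVal x k - 1 / 2)) + 1 / 4 := by
      intro j
      rw [← sum_erase_add _ _ (mem_univ j), ← sq, bitVal_sub_half_sq]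
    simp_rw [hsplit]
    rw [sum_add_distrib, sum_const, card_univ, nsmul_eq_mul]
    ring
  rw [hdecomp, lawMean_add_const sum_uniformCube, lawMean_sum]
  have hjk : ∀ j : V, lawMean (uniformCube V)
      (fun x => ∑ k ∈ univ.erase j, (bitVal x j - 1 / 2) * (bitVal x k - 1 / 2)) = 0 := by
    intro j
    unfold lawMean uniformCube
    rw [← mul_sum]
    have : ∑ x : V → Bool, ∑ k ∈ univ.erase j, (bitVal x j - 1 / 2) * (bitVal x k - 1 / 2) = 0 := by
      rw [sum_comm]
      refine sum_eq_zero fun k hk => ?_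
      exact sum_centered_mul_eq_zero j fun x => by
        rw [bitVal_update_of_ne x (ne_of_mem_erase hk)]
    rw [this, mul_zero]
  simp_rw [hjk]
  rw [sum_const_zero, zero_add]

/-! ## Proposition 7.14 -/

/-- "Using that `(1 − 1/n)^{n−1} > e^{−1}`": for `n ≥ 2`, `α ≥ 1` and `t ≤ ½ n log n − αn`,
**`√n·(1 − 1/n)ᵗ ≥ e^{α−1}`**. [cite: LevinPeres2017, §7.3.1 proof of Prop. 7.14 (the choice of
`t_n` and the display `|E_π(W) − E_𝟙(W(X_{t_n}))| > e^{α−1}σ`)] -/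
theorem sqrt_mul_pow_ge {n : ℝ} (hn : 2 ≤ n) {α : ℝ} (hα : 1 ≤ α) {t : ℝ} (ht0 : 0 ≤ t)
    (ht : t ≤ n * Real.log n / 2 - α * n) :
    Real.exp (α - 1) ≤ Real.sqrt n * (1 - n⁻¹) ^ t := by
  have hn0 : 0 < n := by linarith
  have hn1 : 0 < n - 1 := by linarith
  have hq : 0 < 1 - n⁻¹ := by
    rw [sub_pos, inv_lt_one_iff₀]; right; linarith
  -- `log(1 − 1/n) ≥ −1/(n−1)`
  have hlog : -(1 / (n - 1)) ≤ Real.log (1 - n⁻¹) := by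
    have h := Real.log_le_sub_one_of_pos (show 0 < n / (n - 1) from div_pos hn0 hn1)
    have e1 : n / (n - 1) - 1 = 1 / (n - 1) := by field_simp; ring
    have e2 : Real.log (1 - n⁻¹) = -Real.log (n / (n - 1)) := by
      rw [← Real.log_inv]
      congr 1
      field_simp
    rw [e2]
    linarith [e1 ▸ h]
  -- `½ log n − t/(n−1) ≥ α − 1`
  have hlogn : Real.log n ≤ n - 1 := by linarith [Real.log_le_sub_one_of_pos hn0]
  have hkey : α - 1 ≤ Real.log n / 2 + t * Real.log (1 - n⁻¹) := by
    have h1 : t * (-(1 / (n - 1))) ≤ t * Real.log (1 - n⁻¹) := mul_le_mul_of_nonneg_left hlog ht0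
    have h2 : t / (n - 1) ≤ Real.log n / 2 + 1 - α := by
      rw [div_le_iff₀ hn1]
      nlinarith
    have h3 : t * (-(1 / (n - 1))) = -(t / (n - 1)) := by ring
    linarith
  calc Real.exp (α - 1) ≤ Real.exp (Real.log n / 2 + t * Real.log (1 - n⁻¹)) := Real.exp_le_exp.2 hkey
    _ = Real.sqrt n * (1 - n⁻¹) ^ t := by
        rw [Real.exp_add, Real.sqrt_eq_rpow, Real.rpow_def_of_pos hn0, Real.rpow_def_of_pos hq]
        congr 1 <;> congr 1 <;> ring

/-- **PROPOSITION 7.14.** For the lazy random walk on the `n`-dimensional hypercube (`n ≥ 2`) and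
every natural `t ≤ ½ n log n − αn`: **`d(t) ≥ 1 − 8e^{2−2α}`** (eq. (7.20)); indeed already
`‖Pᵗ(𝟙,·) − π‖_TV ≥ 1 − 8e^{2−2α}` (eq. (7.21)), by Proposition 7.9 with the Hamming weight, `σ = √n/2`
and `r = e^{α−1}`. [cite: LevinPeres2017, §7.3.1 Prop. 7.14, eqs. (7.20)–(7.21)] -/
theorem LevinPeres2017_prop_7_14 (hn : 2 ≤ Fintype.card V) (α : ℝ) {t : ℕ}
    (ht : (t : ℝ) ≤ Fintype.card V * Real.log (Fintype.card V) / 2 - α * Fintype.card V) :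
    1 - 8 * Real.exp (2 - 2 * α) ≤ worstTvDist (lazyHypercubeWalk V) (uniformCube V) t := by
  set n : ℝ := (Fintype.card V : ℝ) with hndef
  set P := lazyHypercubeWalk V
  set one : V → Bool := fun _ => true
  -- trivial when `α ≤ 1`
  rcases le_or_gt α 1 with hα | hα
  · have : 1 - 8 * Real.exp (2 - 2 * α) ≤ 0 := by
      have := Real.exp_le_exp.2 (show (0 : ℝ) ≤ 2 - 2 * α by linarith)
      rw [Real.exp_zero] at this
      linarith
    exact this.trans (worstTvDist_nonneg _ _ _)
  -- Proposition 7.9 with `f = W`, `r = e^{α−1}`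
  have hn2 : (2 : ℝ) ≤ n := by rw [hndef]; exact_mod_cast hn
  have hn0 : 0 < n := by linarith
  set μ := lawAt P (Pi.single one 1) t with hμ
  have hVμ : lawVariance μ bitWeight ≤ n / 4 := var_weight_lawAt_le hn t
  have hVπ : lawVariance (uniformCube V) (bitWeight : (V → Bool) → ℝ) = n / 4 := var_weight_uniform
  have hmax : max (lawVariance μ bitWeight) (lawVariance (uniformCube V) bitWeight) = n / 4 := by
    rw [hVπ]; exact max_eq_right hVμ
  have hσ : 0 < max (lawVariance μ bitWeight) (lawVariance (uniformCube V) bitWeight) := by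
    rw [hmax]; positivity
  have hsqrt : Real.sqrt (n / 4) = Real.sqrt n / 2 := by
    rw [Real.sqrt_div' n (by norm_num : (0 : ℝ) ≤ 4), show (4 : ℝ) = 2 ^ 2 by norm_num,
      Real.sqrt_sq (by norm_num)]
  -- the mean gap: `|E_π W − E_𝟙 W(X_t)| = (n/2)(1 − 1/n)ᵗ ≥ e^{α−1} √n/2`
  have hmeanμ : lawMean μ bitWeight = n / 2 * (1 + (1 - n⁻¹) ^ t) := LevinPeres2017_eq_7_18_weight t
  have hmeanπ : lawMean (uniformCube V) (bitWeight : (V → Bool) → ℝ) = n / 2 := mean_weight_uniform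
  have hkey : Real.exp (α - 1) ≤ Real.sqrt n * (1 - n⁻¹) ^ (t : ℝ) :=
    sqrt_mul_pow_ge hn2 hα.le (Nat.cast_nonneg t) ht
  rw [Real.rpow_natCast] at hkey
  have hq0 : 0 ≤ (1 - n⁻¹) ^ t := pow_nonneg (by
    rw [sub_nonneg]; exact inv_le_one_of_one_le₀ (by linarith)) t
  have h : Real.exp (α - 1) * Real.sqrt (max (lawVariance μ bitWeight)
      (lawVariance (uniformCube V) bitWeight)) ≤
      |lawMean (uniformCube V) bitWeight - lawMean μ bitWeight| := by
    rw [hmax, hsqrt, hmeanπ, hmeanμ]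
    have e : n / 2 - n / 2 * (1 + (1 - n⁻¹) ^ t) = -(n / 2 * (1 - n⁻¹) ^ t) := by ring
    rw [e, abs_neg, abs_of_nonneg (by positivity)]
    have hs : Real.sqrt n * Real.sqrt n = n := Real.mul_self_sqrt hn0.le
    calc Real.exp (α - 1) * (Real.sqrt n / 2) ≤ Real.sqrt n * (1 - n⁻¹) ^ t * (Real.sqrt n / 2) :=
          mul_le_mul_of_nonneg_right hkey (by positivity)
      _ = Real.sqrt n * Real.sqrt n / 2 * (1 - n⁻¹) ^ t := by ring
      _ = n / 2 * (1 - n⁻¹) ^ t := by rw [hs]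
  have h79 := LevinPeres2017_prop_7_9_chain (lazyHypercubeWalk_isRowStochastic (V := V))
    uniformCube_nonneg sum_uniformCube one t bitWeight (Real.exp_pos (α - 1)) hσ h
  have e8 : 1 - 8 / Real.exp (α - 1) ^ 2 = 1 - 8 * Real.exp (2 - 2 * α) := by
    rw [sq, ← Real.exp_add, div_eq_mul_inv, ← Real.exp_neg,
      show -(α - 1 + (α - 1)) = 2 - 2 * α by ring]
  rw [← e8]
  exact h79.trans (tvDist_single_le_worstTvDist P (uniformCube V) t one)

end Hypercube

end Literature.Probability.MarkovChains
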